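import Literature.Probability.RandomPlanarGeometry.BrownianLoopMeasureSimilarity
import Literature.Probability.RandomPlanarGeometry.LoewnerHullCocycle
import Literature.Probability.RandomPlanarGeometry.LoewnerSlidHullStar
import Literature.Probability.RandomPlanarGeometry.LoewnerBoundaryExtension
import HarnessLib

/-!
# The loop mass collected by a growing Loewner hull: the increment identity

Deterministic Loewner calculus behind the loop-measure form of the restriction martingale,
G. F. Lawler, *Partition functions, loop measure, and versions of SLE*, J. Stat. Phys. **134**
(2009) (**[Lawler2009]**), §2.2, display before (4): "If `K₁ = γ_t` is a curve in `D` with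
`γ(0+) = 0`, with corresponding conformal maps `g_t` …, then
`Λ(γ_t, ℍ ∖ D; ℍ) = −(a/6) ∫₀ᵗ SΦ_s(U_s) ds`", whose proof (Lawler–Werner, *The Brownian loop
soup* (2004), Thm. 12; Lawler (2005), Prop. 5.34) rests on the restriction property and the
conformal invariance of the Brownian loop measure: the loops hitting `K_{s+u}` but not `K_s` are
the loops of the slit domain `H_s = ℍ ∖ K_s`, and `g_s` carries them to the loops of `ℍ` hitting
the hull `g_s(K_{s+u} ∖ K_s) = K^{(s)}_u + W_s` of the shifted chain.

For a continuous driving function `W` (hulls `K_t = Loewner.hull W t ⊆ ℍ`, maps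
`g_t = Loewner.map W t`, slid hulls `A_t − W_t = Loewner.slidHull W A t`) and a set
`A ⊆ ℍ̄` not yet reached by the closed hull at time `s`, we PROVE, from the conformal
invariance of `Λ` taken as the hypothesis `hX : loopMass_conformalImage` (the named fact of
`BrownianLoopMeasure`, [LW04] Prop. 6):

* `Loewner.loopMass_hull_add` — restriction:
  `Λ(A, K_{s+u}; ℍ) = Λ(A, K_s; ℍ) + Λ(A, K_{s+u} ∖ K_s; H_s)` (`loopMass_union`);
* `Loewner.image_map_hull_add_sdiff` — `g_s(K_{s+u} ∖ K_s) = K^{W(s+·)−W(s)}_u + W_s`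
  (the hull cocycle `hull_add_sdiff_eq_image_incr`);
* `Loewner.image_map_inter_domain_eq` — `g_s(A ∩ H_s) = (A_s − W_s) ∩ ℍ + W_s` while `A` is
  alive (real points of `A` stay real);
* **`Loewner.loopMass_hull_add_eq_of_conformalImage`** — the increment identity
  `Λ(A, K_{s+u}; ℍ) = Λ(A, K_s; ℍ) + Λ(K^{W(s+·)−W(s)}_u, A_s − W_s; ℍ)`.

No definition and no named fact is introduced.

## References

* [Lawler2009] §2.2 (display before (4)).
* G. F. Lawler, W. Werner, *The Brownian loop soup*, PTRF 128 (2004), Prop. 6, Thm. 12. [LawlerWerner2004]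
* G. F. Lawler, *Conformally Invariant Processes in the Plane* (2005), Rem. 4.9, Prop. 5.27, Prop. 5.34. [Lawler2005]
-/

noncomputable section

open Set Filter Topology MeasureTheory Metric
open UpperHalfPlane (upperHalfPlaneSet isOpen_upperHalfPlaneSet)
open scoped NNReal ENNReal

namespace Literature.Probability.RandomPlanarGeometry

namespace Loewner

variable {W : ℝ≥0 → ℝ} {A : Set ℂ}

/-! ### Restriction: the loops hitting `K_{s+u}` but not `K_s` live in the slit domain -/

/-- The Loewner domain is the complement of the hull in `ℍ`. [folklore] -/
theorem domain_eq_diff (W : ℝ≥0 → ℝ) (t : ℝ≥0) : domain W t = upperHalfPlaneSet \ hull W t := rfl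

/-- `K_s ∪ (K_{s+u} ∖ K_s) = K_{s+u}`. [folklore] -/
theorem hull_union_hull_add_sdiff (W : ℝ≥0 → ℝ) (s u : ℝ≥0) :
    hull W s ∪ (hull W (s + u) \ hull W s) = hull W (s + u) :=
  union_sdiff_cancel (hull_mono W (le_self_add : s ≤ s + u))

/-- **Restriction step**: `Λ(K, K_{s+u}; ℍ) = Λ(K, K_s; ℍ) + Λ(K, K_{s+u} ∖ K_s; H_s)` — a loop in
`ℍ` hitting `K_{s+u}` either hits `K_s`, or is a loop of `H_s = ℍ ∖ K_s` hitting `K_{s+u} ∖ K_s`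
(`loopMass_union`). [cite: Lawler2009, §2.2 (restriction property of the loop measure)] -/
theorem loopMass_hull_add (hW : Continuous W) (s u : ℝ≥0) (K : Set ℂ) :
    loopMass upperHalfPlaneSet K (hull W (s + u)) =
      loopMass upperHalfPlaneSet K (hull W s) + loopMass (domain W s) K (hull W (s + u) \ hull W s) := by
  have hopen : IsOpen (upperHalfPlaneSet \ hull W s) := isOpen_domain hW s
  conv_lhs => rw [← hull_union_hull_add_sdiff W s u, loopMass_union isOpen_upperHalfPlaneSet hopen]
  rfl

/-! ### Transport by `g_s` -/

/-- The Loewner domain is connected (it is the conformal image of `ℍ`). [folklore] -/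
theorem isConnected_domain (hW : Continuous W) (t : ℝ≥0) : IsConnected (domain W t) := by
  refine ⟨?_, ?_⟩
  · obtain ⟨z, hz, -⟩ := (bijOn_map hW t).surjOn (show Complex.I ∈ upperHalfPlaneSet by simp [upperHalfPlaneSet])
    exact ⟨z, hz⟩
  · simpa using isPreconnected_domain_diff hW isBoundedHull_empty (disjoint_empty _) (t := t)

/-- **Transport by `g_s`** (conformal invariance of `Λ`, hypothesis `hX`): for `K₁, K₂ ⊆ H_s`,
`Λ(K₁, K₂; H_s) = Λ(g_s K₁, g_s K₂; ℍ)`. [cite: Lawler2009, §2.2 (conformal invariance of Λ)] -/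
theorem loopMass_domain_eq_of_conformalImage (hX : loopMass_conformalImage) (hW : Continuous W)
    (s : ℝ≥0) {K₁ K₂ : Set ℂ} (h₁ : K₁ ⊆ domain W s) (h₂ : K₂ ⊆ domain W s) :
    loopMass (domain W s) K₁ K₂ = loopMass upperHalfPlaneSet (map W s '' K₁) (map W s '' K₂) := by
  obtain ⟨φ, hφ⟩ := exists_conformalEquiv_map_holds hW s
  have himg : ∀ {K : Set ℂ}, K ⊆ domain W s → (φ : ℂ → ℂ) '' K = map W s '' K := fun hK ↦
    image_congr fun z hz ↦ hφ (hK hz)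
  rw [← hX (isOpen_domain hW s) (isConnected_domain hW s) isOpen_upperHalfPlaneSet φ h₁ h₂, himg h₁, himg h₂]

/-- **`g_s(K_{s+u} ∖ K_s) = K^{W(s+·)−W(s)}_u + W_s`** (the hull cocycle read through `g_s`).
[cite: Lawler2005, Rem. 4.9] -/
theorem image_map_hull_add_sdiff (hW : Continuous W) (s u : ℝ≥0) :
    map W s '' (hull W (s + u) \ hull W s) =
      (fun z : ℂ ↦ z + (W s : ℂ)) '' hull (fun v ↦ W (s + v) - W s) u := by
  rw [hull_add_sdiff_eq_image_incr hW s u, image_image]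
  refine Eq.trans (image_congr fun w hw ↦ ?_) (image_id' _)
  obtain ⟨z, hz, rfl⟩ := hw
  have him : 0 < (z + (W s : ℂ)).im := by simpa using (show 0 < z.im from hz.1)
  exact map_loewnerInv hW s him

/-- The grown hull `K_{s+u} ∖ K_s` lies in the slit domain `H_s`. [folklore] -/
theorem hull_add_sdiff_subset_domain (W : ℝ≥0 → ℝ) (s u : ℝ≥0) :
    hull W (s + u) \ hull W s ⊆ domain W s := fun _ hz ↦ ⟨hz.1.1, hz.2⟩

/-- While `A ⊆ ℍ̄` is alive at time `s`, its points in `ℍ` lie in `H_s`. [folklore] -/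
theorem inter_upperHalfPlaneSet_subset_domain {s : ℝ≥0} (halive : Disjoint (closedHull W s) A) :
    A ∩ upperHalfPlaneSet ⊆ domain W s := fun _ hz ↦
  ⟨hz.2, fun hK ↦ Set.disjoint_left.1 halive (hull_subset_closedHull W s hK) hz.1⟩

/-- **`g_s(A ∩ H_s) = ((A_s − W_s) ∩ ℍ) + W_s` while `A ⊆ ℍ̄` is alive**: the points of `A` in
`ℍ` flow in `ℍ`, the real points of `A` stay real. [cite: LawlerSchrammWerner2003Restriction, §5 (A_t = g_t(A))] -/
theorem image_map_inter_domain_eq (hW : Continuous W) (hAH : A ⊆ closure upperHalfPlaneSet) {s : ℝ≥0}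
    (halive : Disjoint (closedHull W s) A) :
    map W s '' (A ∩ domain W s) =
      (fun z : ℂ ↦ z + (W s : ℂ)) '' (slidHull W A s ∩ upperHalfPlaneSet) := by
  ext w
  simp only [mem_image, mem_inter_iff, mem_slidHull_iff]
  constructor
  · rintro ⟨z, ⟨hzA, hzD⟩, rfl⟩
    refine ⟨map W s z - W s, ⟨⟨z, hzA, rfl⟩, ?_⟩, by ring⟩
    show 0 < (map W s z - (W s : ℂ)).im
    simpa using (show 0 < (map W s z).im from mapsTo_map hW s hzD)
  · rintro ⟨v, ⟨⟨z, hzA, rfl⟩, hv⟩, rfl⟩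
    refine ⟨z, ⟨hzA, ?_⟩, by ring⟩
    -- `z` is in `ℍ` (a real point of `A` would have a real image) and is alive
    have him : 0 ≤ z.im := by
      have := hAH hzA
      rwa [show upperHalfPlaneSet = {z : ℂ | 0 < z.im} from rfl, Complex.closure_setOf_lt_im] at this
    rcases him.eq_or_lt with h0 | hpos
    · exfalso
      have hT : (s : WithTop ℝ≥0) < swallowingTime W z := lt_swallowingTime_of_disjoint_closedHull hAH halive hzA
      have hz : z = ((z.re : ℝ) : ℂ) := Complex.ext (by simp) (by simp [← h0])
      rw [hz] at hT
      have hreal : (map W s ((z.re : ℝ) : ℂ)).im = 0 := map_ofReal_im hW hT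
      have : 0 < (map W s z - (W s : ℂ)).im := hv
      rw [hz] at this
      simp [hreal] at this
    · exact inter_upperHalfPlaneSet_subset_domain halive ⟨hzA, hpos⟩

/-! ### Translation by `−W_s` -/

/-- A real translate of `ℍ` is `ℍ`. [folklore] -/
theorem image_add_real_upperHalfPlaneSet (c : ℝ) :
    (fun z : ℂ ↦ z + (c : ℂ)) '' upperHalfPlaneSet = upperHalfPlaneSet := by
  ext w
  simp only [mem_image]
  constructor
  · rintro ⟨z, hz, rfl⟩
    show 0 < (z + (c : ℂ)).im
    simpa using (show 0 < z.im from hz)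
  · intro hw
    refine ⟨w - c, ?_, by ring⟩
    show 0 < (w - (c : ℂ)).im
    simpa using (show 0 < w.im from hw)

/-- **Translation invariance of `Λ` in `ℍ`** (real shifts; `loopMass_similarity` with `a = 1`).
[cite: Lawler2009, §2.2 (conformal invariance of Λ)] -/
theorem loopMass_image_add_real (c : ℝ) {K₁ K₂ : Set ℂ} (h₁ : K₁ ⊆ upperHalfPlaneSet)
    (h₂ : K₂ ⊆ upperHalfPlaneSet) :
    loopMass upperHalfPlaneSet ((fun z : ℂ ↦ z + (c : ℂ)) '' K₁) ((fun z : ℂ ↦ z + (c : ℂ)) '' K₂) =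
      loopMass upperHalfPlaneSet K₁ K₂ := by
  have h := loopMass_similarity (a := 1) (b := (c : ℂ)) (s := fun z : ℂ ↦ z + (c : ℂ)) one_pos
    (fun z ↦ by push_cast; ring) isOpen_upperHalfPlaneSet h₁ h₂
  rwa [image_add_real_upperHalfPlaneSet] at h

/-! ### The increment identity -/

/-- **The increment identity** ([Lawler2009] §2.2 / [LW04] Thm. 12, deterministic core): for a
continuous driving function `W`, a set `A ⊆ ℍ̄` alive at time `s` (`K̄_s ∩ A = ∅`) and `u ≥ 0`,
`Λ(A, K_{s+u}; ℍ) = Λ(A, K_s; ℍ) + Λ(K^{W(s+·)−W(s)}_u, A_s − W_s; ℍ)`: the loops newly hit between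
`s` and `s + u` are the loops of `H_s` hitting `K_{s+u} ∖ K_s` (restriction), which `g_s − W_s`
carries onto the loops of `ℍ` hitting the hull at time `u` of the chain driven by the increments
`W(s + ·) − W(s)` and the slid hull `A_s − W_s` (conformal invariance `hX`, translation). Only the
part of `A_s − W_s` in `ℍ` matters (`loopMass_inter_dom`).
[cite: Lawler2009, §2.2 (display before (4))] -/
theorem loopMass_hull_add_eq_of_conformalImage (hX : loopMass_conformalImage) (hW : Continuous W)
    (hAH : A ⊆ closure upperHalfPlaneSet) {s : ℝ≥0} (halive : Disjoint (closedHull W s) A) (u : ℝ≥0) :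
    loopMass upperHalfPlaneSet A (hull W (s + u)) =
      loopMass upperHalfPlaneSet A (hull W s) +
        loopMass upperHalfPlaneSet (hull (fun v ↦ W (s + v) - W s) u) (slidHull W A s) := by
  rw [loopMass_hull_add hW s u A]
  congr 1
  have hD := isOpen_domain hW s
  -- only `A ∩ H_s` matters in the slit domain
  rw [← loopMass_inter_dom hD A]
  have hAs : A ∩ domain W s = (A ∩ upperHalfPlaneSet) ∩ domain W s := by
    rw [inter_assoc, inter_eq_right.2 (domain_subset W s)]
  have hsub : A ∩ domain W s ⊆ domain W s := inter_subset_right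
  -- transport by `g_s`, rewrite the images, translate back by `−W_s`
  rw [loopMass_domain_eq_of_conformalImage hX hW s hsub (hull_add_sdiff_subset_domain W s u),
    image_map_inter_domain_eq hW hAH halive, image_map_hull_add_sdiff hW s u,
    loopMass_image_add_real (W s) inter_subset_right (hull_subset _ u),
    loopMass_inter_dom isOpen_upperHalfPlaneSet, loopMass_comm]

end Loewner

end Literature.Probability.RandomPlanarGeometry

end
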